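import Summits.QuantumFields.GaugeBoot.Rows.GLYZc1D4STab
import HarnessLib

/-!
# Gauge-boot: kernel check of the raw `site1` class table, rows 47–143 (part 2/2)

Cell `pub-gaugeboot` (HOME `run/shared/lean/pub/pub-gaugeboot/`), seat lean1 (binding layer for rows C20–C31 = the certified
glyz-c1-rp-4D windows, FANOUT-PLAN A126 (2): label sets, class/witness tables, the reduction identity, soundness, per-β bindings).

HONEST FRAMING (page 1 of every file of this cell): certified bounds on lattice expectations at STATED coupling,
gauge group, dimension and torus size; NOT a mass gap, NOT a continuum limit, NOT a string tension, NOT large `N`.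
The venture is explicitly NOT Yang–Mills-summit-bearing (barriers `FixedCouplingUltralocality`,
`PerturbativeInvisibility`).

`scanon_rows_<lo>_<hi> : ∀ i, lo ≤ i < hi → ∀ j ≥ i, SCanonOK i j`, each range one closed computation (`decide +kernel`);
assembled in `GLYZc1D4Canon`.
-/

noncomputable section

open Literature.MathematicalPhysics.QuantumFieldTheory

namespace Summit.QuantumFields.GaugeBoot

namespace GLYZc1D4

set_option maxHeartbeats 0 in
/-- Rows `47 ≤ i < 60` of the `site1` class table canonicalise (1183 entries; closed computation checked by the kernel). -/
theorem scanon_rows_47_60 : ∀ i : Fin 144, 47 ≤ i.val → i.val < 60 → ∀ j : Fin 144, i.val ≤ j.val → SCanonOK i j := by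
  decide +kernel

set_option maxHeartbeats 0 in
/-- Rows `60 ≤ i < 75` of the `site1` class table canonicalise (1155 entries; closed computation checked by the kernel). -/
theorem scanon_rows_60_75 : ∀ i : Fin 144, 60 ≤ i.val → i.val < 75 → ∀ j : Fin 144, i.val ≤ j.val → SCanonOK i j := by
  decide +kernel

set_option maxHeartbeats 0 in
/-- Rows `75 ≤ i < 94` of the `site1` class table canonicalise (1140 entries; closed computation checked by the kernel). -/
theorem scanon_rows_75_94 : ∀ i : Fin 144, 75 ≤ i.val → i.val < 94 → ∀ j : Fin 144, i.val ≤ j.val → SCanonOK i j := by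
  decide +kernel

set_option maxHeartbeats 0 in
/-- Rows `94 ≤ i < 126` of the `site1` class table canonicalise (1104 entries; closed computation checked by the kernel). -/
theorem scanon_rows_94_126 : ∀ i : Fin 144, 94 ≤ i.val → i.val < 126 → ∀ j : Fin 144, i.val ≤ j.val → SCanonOK i j := by
  decide +kernel

set_option maxHeartbeats 0 in
/-- Rows `126 ≤ i < 144` of the `site1` class table canonicalise (171 entries; closed computation checked by the kernel). -/
theorem scanon_rows_126_144 : ∀ i : Fin 144, 126 ≤ i.val → i.val < 144 → ∀ j : Fin 144, i.val ≤ j.val → SCanonOK i j := by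
  decide +kernel

end GLYZc1D4

end Summit.QuantumFields.GaugeBoot

end
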